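import Summits.BirchSwinnertonDyer.BirchSwinnertonDyer.Theorems.Rank2Observatory2DescClRealCurveCertSSQDefs
import Summits.BirchSwinnertonDyer.BirchSwinnertonDyer.Theorems.Rank2Observatory2DescClCurveCertE2SQSoundB
import Summits.BirchSwinnertonDyer.BirchSwinnertonDyer.Theorems.Rank2Observatory2DescClCurveCertSSound
import HarnessLib

/-!
# BirchSwinnertonDyer — rank ≥ 2 observatory: KERNEL-2DESC-CL v3.0, SSQ3 — ENTRY-LEVEL SOUNDNESS OF THE SPLIT-2 CHECKERS OVER A TOTALLY SPLIT `q`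

HONEST FRAMING: per-curve certified theorems and census instruments; no claim on BSD in rank ≥ 2.

Third generic file of the «SSQ» variant: the entry-level soundness of the SSQ2 checkers — the landed
`…ClCurveCertSSound` text (non-vanishing and norm of a fractional element, the projections of `famCheckS3`,
soundness of the prime dispatch `dispatch_soundS3`, `exists_prime_of_memS3`, the support-code clause
`codeClauseS3_true/false`, the support lemma `supp_of_famCheckS3`) and `eltS3_eq_q` of `…ClCurveCertSMain` over the
SSQ2 record types with the split-`q` core `checkCoreS3` (SSQ1) in place of `checkCoreS`; then NEW: **`log ord_{W_j}(x)
= famL3S j`** at the three primes above `q` (`log_WQ_of_famCheckS3`: the element `q` by SQ1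
`log_valuation_WQ_natCast`; a generic `x = X / m₁` by the single-prime squeeze `log_valuation_WQ_eq_of_not_mem` at
its carrier and `invCert` at the other two — the S reading of SQ4 `log_WQ_of_famCheckE3`), and the code primes of
the support `codePrimeS3`.  The `F`-level lemmas without a core hypothesis (`m₁_mul_eltS`, `rho_eltS`,
`m₁_not_mem_of_q`, …) are the landed ones, cited by name.
Sorry-free; axioms `propext`, `Classical.choice`, `Quot.sound`.
[cite: Cassels1991LecturesEllipticCurves, §15] [cite: Marcus2018, Ch. 3, Thm. 22] [cite: Cohen1993, §4.8.2, §4.8.3]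
-/

set_option linter.dupNamespace false

noncomputable section

open scoped Classical NumberField nonZeroDivisors

open Literature.NumberTheory.NumberFields Polynomial Module NumberField IsDedekindDomain Ideal

namespace Summit.BirchSwinnertonDyer.BirchSwinnertonDyer.Rank2Observatory.TwoDescCl

open TwoDescCubic ClFieldCert

section Sound

variable {K : Type*} [Field K] [NumberField K] {θ : K} {F : ClFieldCertS2}

/-- A fractional element with non-zero `α`-norm form is non-zero. -/
theorem eltS_ne_zero3 (hθ : aeval θ (MonicCubic.poly F.fs.base.a F.fs.base.b F.fs.base.c) = 0)
    (h3 : finrank ℚ K = 3) (hS : F.fs.checkCoreS3 = true) {X tsn : ℤ × ℤ × ℤ}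
    (h : (fracOf F X tsn).check F.fs.base.a F.fs.base.b F.fs.base.c = true)
    (hN : normFormZ F.fs.base.a F.fs.base.b F.fs.base.c X.1 X.2.1 X.2.2 ≠ 0) :
    (fracOf F X tsn).toInt hθ h ≠ 0 := by
  intro h0
  have e := m₁_mul_eltS hθ h
  rw [h0, mul_zero] at e
  exact lin_ne_zero_of_coords (F.fs.base.irreducible_of_reg3 (F.fs.checkReg3_of_coreS3 hS)) hθ h3 X hN e.symm

/-- **Norm of a fractional element**: `N(x) = N(X) / m₁³`. [cite: Marcus2018, Ch. 2, Thm. 4] -/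
theorem norm_eltS3 (hθ : aeval θ (MonicCubic.poly F.fs.base.a F.fs.base.b F.fs.base.c) = 0)
    (h3 : finrank ℚ K = 3) (hS : F.fs.checkCoreS3 = true) (hK : F.checkConst = true) {X tsn : ℤ × ℤ × ℤ}
    (h : (fracOf F X tsn).check F.fs.base.a F.fs.base.b F.fs.base.c = true)
    (hdvd : ((F.m₁ : ℤ)) ^ 3 ∣ normFormZ F.fs.base.a F.fs.base.b F.fs.base.c X.1 X.2.1 X.2.2) :
    Algebra.norm ℚ (algebraMap (𝓞 K) K ((fracOf F X tsn).toInt hθ h)) =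
      ((normFormZ F.fs.base.a F.fs.base.b F.fs.base.c X.1 X.2.1 X.2.2 / (F.m₁ : ℤ) ^ 3 : ℤ) : ℚ) := by
  have hirr := F.fs.base.irreducible_of_reg3 (F.fs.checkReg3_of_coreS3 hS)
  have e := m₁_mul_eltS_coe hθ h
  have hN := norm_lin_coords hirr hθ h3 X
  rw [RingOfIntegers.coe_eq_algebraMap, ← e, map_mul] at hN
  have hm : Algebra.norm ℚ ((F.m₁ : K)) = (F.m₁ : ℚ) ^ 3 := by
    rw [show ((F.m₁ : K)) = algebraMap ℚ K (F.m₁ : ℚ) by simp, Algebra.norm_algebraMap, h3]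
  rw [hm] at hN
  have hm0 : ((F.m₁ : ℚ)) ^ 3 ≠ 0 := pow_ne_zero 3 (Nat.cast_ne_zero.mpr (F.m₁_pos hK).ne')
  have hm0' : (((F.m₁ : ℤ) ^ 3 : ℤ) : ℚ) ≠ 0 := by push_cast; exact hm0
  rw [Int.cast_div hdvd hm0']
  push_cast
  rw [eq_div_iff hm0]
  linear_combination hN

variable {cc : ClCurveCertS3} {f : FamEntryS3}

/-- The norm form of `X` of a checked family entry is non-zero. -/
theorem normFormZ_ne_of_famCheckS3 (h : famCheckS3 F cc f = true) :
    normFormZ F.fs.base.a F.fs.base.b F.fs.base.c f.X.1 f.X.2.1 f.X.2.2 ≠ 0 := by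
  simp only [famCheckS3, Bool.and_eq_true, decide_eq_true_eq] at h; exact h.1.1.1.1.1.2

/-- The norm-divisibility clause of a checked family entry. -/
theorem dvd_of_famCheckS3 (h : famCheckS3 F cc f = true) :
    ((F.m₁ : ℤ)) ^ 3 ∣ normFormZ F.fs.base.a F.fs.base.b F.fs.base.c f.X.1 f.X.2.1 f.X.2.2 := by
  simp only [famCheckS3, Bool.and_eq_true, decide_eq_true_eq] at h; exact h.1.1.1.1.2

/-- The non-divisibility clause of a checked family entry at the characters. -/
theorem not_dvd_evalInt_of_famCheckS3 (h : famCheckS3 F cc f = true) {ch : ℕ × ℤ × ℤ}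
    (hch : ch ∈ F.fs.base.chars) : ¬ (ch.1 : ℤ) ∣ evalInt ch.2.1 f.X := by
  simp only [famCheckS3, Bool.and_eq_true, List.all_eq_true, Bool.not_eq_true', decide_eq_false_iff_not] at h
  exact h.1.1.1.2 ch hch

/-- The absolute-norm clause of a checked family entry. -/
theorem natAbs_of_famCheckS3 (h : famCheckS3 F cc f = true) :
    (normFormZ F.fs.base.a F.fs.base.b F.fs.base.c f.X.1 f.X.2.1 f.X.2.2).natAbs =
      (f.nf.map fun pe => pe.1 ^ pe.2).prod := by
  simp only [famCheckS3, Bool.and_eq_true, decide_eq_true_eq] at h; exact h.1.1.2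

/-- The per-prime dispatch clause of a checked family entry. -/
theorem dispatch_of_famCheckS3 (h : famCheckS3 F cc f = true) :
    ∀ pe ∈ f.nf, primeDispatchS3 F cc (fracOf F f.X f.tsn) f.X f.invsA f.miss2 pe.1 = true := by
  simp only [famCheckS3, Bool.and_eq_true, List.all_eq_true] at h; exact h.1.2

/-- The kind clause of a checked family entry. -/
theorem kind_of_famCheckS3 (h : famCheckS3 F cc f = true) : famKindCheckS3 F f = true := by
  simp only [famCheckS3, Bool.and_eq_true] at h; exact h.2

/-! ### The prime dispatch is sound -/

/-- An exclusion witness at `w_i` is sound: `x ∉ w_i`. -/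
theorem not_mem_of_missAt3 (hθ : aeval θ (MonicCubic.poly F.fs.base.a F.fs.base.b F.fs.base.c) = 0)
    (h3 : finrank ℚ K = 3) (hS : F.fs.checkCoreS3 = true) {x : FracElt}
    (cx : x.check F.fs.base.a F.fs.base.b F.fs.base.c = true) {miss2 : List (Fin 3 × FracElt × FracElt)}
    {i : Fin 3} (h : missAt F x miss2 i = true) :
    x.toInt hθ cx ∉ (SplitTwo.w (F.fs.base.irreducible_of_reg3 (F.fs.checkReg3_of_coreS3 hS)) hθ h3
      (F.fs.splitCheck_of_coreS3 hS) i).asIdeal := by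
  simp only [missAt, List.any_eq_true, Bool.and_eq_true, decide_eq_true_eq] at h
  obtain ⟨ws, -, rfl, cs, ct, hlin⟩ := h
  exact SplitTwo.not_mem_w_of_linCheck _ hθ h3 _ ws.1 cx cs ct hlin

/-- **Soundness of the prime dispatch**: if `x ∈ w`, `m₁x = X(α)`, and a rational prime `l ∈ w` is dispatched,
then `w ∋ q`, or `w` is the prime of a support `α`-code (and misses `m₁`), or `w` is a support split prime.
[folklore] -/
theorem dispatch_soundS3 (hθ : aeval θ (MonicCubic.poly F.fs.base.a F.fs.base.b F.fs.base.c) = 0)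
    (h3 : finrank ℚ K = 3) (hS : F.fs.checkCoreS3 = true) (hK : F.checkConst = true)
    (hpr : F.fs.base.primeList.Forall Nat.Prime) {x : FracElt}
    (cx : x.check F.fs.base.a F.fs.base.b F.fs.base.c = true) {X : ℤ × ℤ × ℤ}
    (hxX : (F.m₁ : 𝓞 K) * x.toInt hθ cx = lin hθ X.1 X.2.1 X.2.2) {invsA : List (PCode × (ℤ × ℤ × ℤ))}
    {miss2 : List (Fin 3 × FracElt × FracElt)} {l : ℕ} (hdisp : primeDispatchS3 F cc x X invsA miss2 l = true)
    (w : HeightOneSpectrum (𝓞 K)) (hlw : (l : 𝓞 K) ∈ w.asIdeal) (hx : x.toInt hθ cx ∈ w.asIdeal) :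
    ((F.fs.base.q : ℕ) : 𝓞 K) ∈ w.asIdeal ∨
      (∃ C, (true, C) ∈ cc.codes.map Prod.fst ∧ (F.fs.base.primes.any fun e => e.p == C.1) = true ∧
        C ∈ (F.fs.base.row C.1).codes ∧ w.asIdeal = idealOf hθ C ∧ (F.m₁ : 𝓞 K) ∉ w.asIdeal) ∨
      (∃ i : Fin 3, (false, ((i : ℕ), (0 : ℤ), (0 : ℤ), (0 : ℤ))) ∈ cc.codes.map Prod.fst ∧
        w = SplitTwo.w (F.fs.base.irreducible_of_reg3 (F.fs.checkReg3_of_coreS3 hS)) hθ h3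
          (F.fs.splitCheck_of_coreS3 hS) i) := by
  have hR := F.fs.checkReg3_of_coreS3 hS
  have hirr := F.fs.base.irreducible_of_reg3 hR
  have hXw : lin hθ X.1 X.2.1 X.2.2 ∈ w.asIdeal := by rw [← hxX]; exact Ideal.mul_mem_left _ _ hx
  simp only [primeDispatchS3, Bool.or_eq_true, Bool.and_eq_true, beq_iff_eq, List.all_eq_true, List.any_eq_true,
    decide_eq_true_eq] at hdisp
  rcases hdisp with (rfl | ⟨hany, hall⟩) | ⟨rfl, hall⟩
  · exact Or.inl hlw
  · have hany' : (F.fs.base.primes.any fun e => e.p == l) = true := by simpa [List.any_eq_true] using hany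
    obtain ⟨hrow, hrowp⟩ := row_mem hany'
    have hpp : (F.fs.base.row l).p.Prime := F.fs.base.prime_of_mem hpr hrow
    have hlw' : ((F.fs.base.row l).p : 𝓞 K) ∈ w.asIdeal := by rw [hrowp]; exact hlw
    obtain ⟨C', hC', hw'⟩ :=
      exists_code_of_natCast_mem hirr hθ h3 hpp (F.fs.base.row_check_of_mem_reg3 hR hrow).1 w hlw'
    rcases hall C' hC' with hmem | ⟨ci, -, hci, hinv⟩
    · refine Or.inr (Or.inl ⟨C', hmem, ?_, ?_, hw', ?_⟩)
      · rw [code_fst_of_mem hC', hrowp]; exact hany'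
      · rw [code_fst_of_mem hC', hrowp]; exact hC'
      · exact m₁_not_mem_of_row hK hrow w hlw'
    · exact absurd hXw (lin_not_mem_of_invCert hθ w hw' hinv)
  · obtain ⟨i, hi⟩ := SplitTwo.eq_w_of_two_mem hirr hθ h3 (F.fs.splitCheck_of_coreS3 hS) w hlw
    rcases hall i with hmem | hmiss
    · exact Or.inr (Or.inr ⟨i, hmem, hi⟩)
    · exact absurd (hi ▸ hx) (not_mem_of_missAt3 hθ h3 hS cx hmiss)

/-- A rational prime below a prime containing `X(α)`, read on the `α`-norm form of `X`. -/
theorem exists_prime_of_memS3 (hθ : aeval θ (MonicCubic.poly F.fs.base.a F.fs.base.b F.fs.base.c) = 0)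
    (h3 : finrank ℚ K = 3) (hS : F.fs.checkCoreS3 = true) {X : ℤ × ℤ × ℤ}
    (hN : normFormZ F.fs.base.a F.fs.base.b F.fs.base.c X.1 X.2.1 X.2.2 ≠ 0) {nf : List (ℕ × ℕ)}
    (hnf : (normFormZ F.fs.base.a F.fs.base.b F.fs.base.c X.1 X.2.1 X.2.2).natAbs =
      (nf.map fun pe => pe.1 ^ pe.2).prod)
    (w : HeightOneSpectrum (𝓞 K)) (hX : lin hθ X.1 X.2.1 X.2.2 ∈ w.asIdeal) :
    ∃ pe ∈ nf, (pe.1 : 𝓞 K) ∈ w.asIdeal := by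
  have hirr := F.fs.base.irreducible_of_reg3 (F.fs.checkReg3_of_coreS3 hS)
  have hX0 : lin hθ X.1 X.2.1 X.2.2 ≠ 0 := lin_ne_zero_of_coords hirr hθ h3 X hN
  obtain ⟨l, hl, hldvd, hlw⟩ := exists_prime_dvd_norm_mem w hX0 hX
  rw [natAbs_norm_lin_coords hirr hθ h3, hnf] at hldvd
  obtain ⟨a, ha, hla⟩ := (Prime.dvd_prod_iff hl.prime).mp hldvd
  obtain ⟨pe, hpe, rfl⟩ := List.mem_map.mp ha
  obtain ⟨k, hk⟩ := hl.dvd_of_dvd_pow hla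
  refine ⟨pe, hpe, ?_⟩
  rw [hk, Nat.cast_mul]
  exact Ideal.mul_mem_right _ _ hlw

/-! ### The support-code clause -/

/-- The support-code clause, `α`-code branch. -/
theorem codeClauseS3_true {bc : (Bool × PCode) × FamEntryS3} (h : codeClauseS3 F cc bc = true) (hb : bc.1.1 = true) :
    (F.fs.base.primes.any fun e => e.p == bc.1.2.1) = true ∧ bc.1.2 ∈ (F.fs.base.row bc.1.2.1).codes ∧
      memCode bc.1.2 cc.XD = true := by
  unfold codeClauseS3 at h
  rw [hb] at h
  simp only [↓reduceIte, Bool.and_eq_true, decide_eq_true_eq] at h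
  exact ⟨h.1.1, h.1.2, h.2⟩

/-- The support-code clause, split branch: the code is `(i, 0, 0, 0)` with `i < 3` and `D ∈ w_i`. -/
theorem codeClauseS3_false (hθ : aeval θ (MonicCubic.poly F.fs.base.a F.fs.base.b F.fs.base.c) = 0)
    (h3 : finrank ℚ K = 3) (hS : F.fs.checkCoreS3 = true)
    (hD : (fracOf F cc.XD cc.tsnD).check F.fs.base.a F.fs.base.b F.fs.base.c = true)
    {bc : (Bool × PCode) × FamEntryS3} (h : codeClauseS3 F cc bc = true) (hb : bc.1.1 = false) :
    ∃ i : Fin 3, bc.1.2 = ((i : ℕ), (0 : ℤ), (0 : ℤ), (0 : ℤ)) ∧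
      (fracOf F cc.XD cc.tsnD).toInt hθ hD ∈ (SplitTwo.w (F.fs.base.irreducible_of_reg3
        (F.fs.checkReg3_of_coreS3 hS)) hθ h3 (F.fs.splitCheck_of_coreS3 hS) i).asIdeal := by
  unfold codeClauseS3 at h
  rw [hb] at h
  simp only [Bool.false_eq_true, ↓reduceIte, Bool.and_eq_true, decide_eq_true_eq, List.any_eq_true] at h
  obtain ⟨hcode, ws, -, hws, cs, ct, hlin⟩ := h
  refine ⟨ws.1, ?_, SplitTwo.mem_w_of_linCheck _ hθ h3 _ ws.1 hD cs ct hlin⟩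
  rw [hcode, ← hws]

/-! ### Support of a family element -/

/-- **Support**: every prime containing the family element `x` contains `M = D · q`.
[cite: Cassels1991LecturesEllipticCurves, §15] -/
theorem supp_of_famCheckS3 (hθ : aeval θ (MonicCubic.poly F.fs.base.a F.fs.base.b F.fs.base.c) = 0)
    (h3 : finrank ℚ K = 3) (hS : F.fs.checkCoreS3 = true) (hK : F.checkConst = true)
    (hpr : F.fs.base.primeList.Forall Nat.Prime) (hcodes : ∀ bc ∈ cc.codes, codeClauseS3 F cc bc = true)
    (hD : (fracOf F cc.XD cc.tsnD).check F.fs.base.a F.fs.base.b F.fs.base.c = true)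
    (h : famCheckS3 F cc f = true) :
    ∀ v : HeightOneSpectrum (𝓞 K), (fracOf F f.X f.tsn).toInt hθ (frac_of_famCheckS3 h) ∈ v.asIdeal →
      (fracOf F cc.XD cc.tsnD).toInt hθ hD * ((F.fs.base.q : ℕ) : 𝓞 K) ∈ v.asIdeal := by
  intro v hv
  have hxX := m₁_mul_eltS hθ (frac_of_famCheckS3 h)
  have hXv : lin hθ f.X.1 f.X.2.1 f.X.2.2 ∈ v.asIdeal := by rw [← hxX]; exact Ideal.mul_mem_left _ _ hv
  obtain ⟨pe, hpe, hpv⟩ :=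
    exists_prime_of_memS3 hθ h3 hS (normFormZ_ne_of_famCheckS3 h) (natAbs_of_famCheckS3 h) v hXv
  rcases dispatch_soundS3 (cc := cc) hθ h3 hS hK hpr (frac_of_famCheckS3 h) hxX (dispatch_of_famCheckS3 h pe hpe)
      v hpv hv with hq | ⟨C, hmem, -, -, hw, hm₁⟩ | ⟨i, hmem, hw⟩
  · exact Ideal.mul_mem_left _ _ hq
  · obtain ⟨bc, hbc, hbc1⟩ := List.mem_map.mp hmem
    obtain ⟨-, -, hmc⟩ := codeClauseS3_true (hcodes bc hbc) (by rw [hbc1])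
    have hC : bc.1.2 = C := by rw [hbc1]
    rw [hC] at hmc
    have hXD : lin hθ cc.XD.1 cc.XD.2.1 cc.XD.2.2 ∈ v.asIdeal := lin_mem_of_memCode hθ v hw cc.XD hmc
    exact Ideal.mul_mem_right _ _ ((mem_iff_of_natCast_mul_eq v hm₁ (m₁_mul_eltS hθ hD)).mpr hXD)
  · obtain ⟨bc, hbc, hbc1⟩ := List.mem_map.mp hmem
    obtain ⟨i', hcode, hDi⟩ := codeClauseS3_false hθ h3 hS hD (hcodes bc hbc) (by rw [hbc1])
    have hii : ((i' : ℕ) : ℕ) = (i : ℕ) := by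
      have e := congrArg (fun z : Bool × PCode => z.2.1) hbc1
      simp only at e
      rw [hcode] at e
      exact e
    have hi : i' = i := Fin.ext hii
    subst hi
    rw [hw]
    exact Ideal.mul_mem_right _ _ hDi

/-! ### `log ord` at the three primes above `q` -/

/-- The element `q` of the family is literally `q`. -/
theorem eltS3_eq_q (hθ : aeval θ (MonicCubic.poly F.fs.base.a F.fs.base.b F.fs.base.c) = 0)
    (hK : F.checkConst = true) (h : famCheckS3 F cc f = true) (h1 : f.kind = 1) :
    (fracOf F f.X f.tsn).toInt hθ (frac_of_famCheckS3 h) = ((F.fs.base.q : ℕ) : 𝓞 K) := by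
  have hk := kind_of_famCheckS3 h
  unfold famKindCheckS3 at hk
  rw [if_pos h1, decide_eq_true_eq] at hk
  have hX : lin hθ f.X.1 f.X.2.1 f.X.2.2 = (F.m₁ : 𝓞 K) * ((F.fs.base.q : ℕ) : 𝓞 K) := by
    rw [hk]
    simp only
    rw [lin_const hθ]
    push_cast
    ring
  exact mul_left_cancel₀ (m₁S_ne_zero_O hK) ((m₁_mul_eltS hθ (frac_of_famCheckS3 h)).trans hX)

/-- **`log ord_{W_j}(x) = famL3S j`** for a checked split-2 family element over a totally split `q`: the element `q`
has `ord = 1` at each `W_j` (SQ1 `log_valuation_WQ_natCast`); a generic element `x = X / m₁` (`q ∤ m₁`) has the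
certified order `e` at its carrier `W_c` (single-prime norm squeeze over `U_q`, SQ1 `log_valuation_WQ_eq_of_not_mem`,
the other two primes excluded by `invCert`) and `ord = 0` at the other two.
[cite: Marcus2018, Ch. 3, Thm. 22] [cite: Cohen1993, §4.8.2, §4.8.3] -/
theorem log_WQ_of_famCheckS3 (hθ : aeval θ (MonicCubic.poly F.fs.base.a F.fs.base.b F.fs.base.c) = 0)
    (h3 : finrank ℚ K = 3) (hS : F.fs.checkCoreS3 = true) (hK : F.checkConst = true)
    (hpr : F.fs.base.primeList.Forall Nat.Prime) (h : famCheckS3 F cc f = true) (j : Fin 3) :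
    WithZero.log ((F.fs.base.WQ hθ h3 (F.fs.checkReg3_of_coreS3 hS) hpr j).valuation K
      (((fracOf F f.X f.tsn).toInt hθ (frac_of_famCheckS3 h) : 𝓞 K) : K)) = famL3S j f := by
  have hR := F.fs.checkReg3_of_coreS3 hS
  -- the two indices of `Fin 3` other than `c` (kept local, as in SQ4 `log_WQ_of_famCheckE3`)
  have key : ∀ c j : Fin 3, j ≠ c → j = c + 1 ∨ j = c + 2 := by decide
  unfold famL3S
  by_cases h1 : f.kind = 1
  · rw [if_pos h1, eltS3_eq_q hθ hK h h1]
    exact log_valuation_WQ_natCast hθ h3 hR hpr j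
  rw [if_neg h1]
  have hk := kind_of_famCheckS3 h
  unfold famKindCheckS3 at hk
  rw [if_neg h1, Bool.and_eq_true, Bool.and_eq_true] at hk
  obtain ⟨⟨hinv2, hinv3⟩, hord⟩ := hk
  have hdisp := valuation_eq_of_natCast_mul_eq (F.fs.base.WQ hθ h3 hR hpr j)
    (m₁_not_mem_of_q hK _ (q_mem_WQ hθ h3 hR hpr j)) (m₁_mul_eltS hθ (frac_of_famCheckS3 h))
  rw [hdisp]
  by_cases hj : j = f.c
  · rw [if_pos hj]
    obtain ⟨hN, hm⟩ := natAbs_norm_of_ordCheck_reg3 hθ h3 hR hord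
    refine log_valuation_WQ_eq_of_not_mem hθ h3 hR hpr j (fun j' hj' => ?_) hN hm
    rcases key _ _ (hj ▸ hj' : j' ≠ f.c) with rfl | rfl
    · exact lin_not_mem_of_invCert hθ _ (WQ_asIdeal hθ h3 hR hpr _) hinv2
    · exact lin_not_mem_of_invCert hθ _ (WQ_asIdeal hθ h3 hR hpr _) hinv3
  · rw [if_neg hj]
    rcases key _ _ hj with rfl | rfl
    · rw [valuation_eq_one_of_invCert hθ _ (WQ_asIdeal hθ h3 hR hpr _) hinv2, WithZero.log_one]
    · rw [valuation_eq_one_of_invCert hθ _ (WQ_asIdeal hθ h3 hR hpr _) hinv3, WithZero.log_one]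

/-! ### The code primes of the support -/

variable (F) in
/-- The height-one prime of a tagged support code (split-`q` reading): an `α`-code prime (SQ2 `codePrimeR3`), or
the split prime `w_i`, `i = code.1` (junk `WQ 0` otherwise). -/
def codePrimeS3 (hθ : aeval θ (MonicCubic.poly F.fs.base.a F.fs.base.b F.fs.base.c) = 0) (h3 : finrank ℚ K = 3)
    (hS : F.fs.checkCoreS3 = true) (hpr : F.fs.base.primeList.Forall Nat.Prime)
    (bc : (Bool × PCode) × FamEntryS3) : HeightOneSpectrum (𝓞 K) :=
  if bc.1.1 = true then codePrimeR3 hθ h3 (F.fs.checkReg3_of_coreS3 hS) hpr bc.1.2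
  else if h : bc.1.2.1 < 3 then SplitTwo.w (F.fs.base.irreducible_of_reg3 (F.fs.checkReg3_of_coreS3 hS)) hθ h3
    (F.fs.splitCheck_of_coreS3 hS) ⟨bc.1.2.1, h⟩
  else F.fs.base.WQ hθ h3 (F.fs.checkReg3_of_coreS3 hS) hpr 0

end Sound

end Summit.BirchSwinnertonDyer.BirchSwinnertonDyer.Rank2Observatory.TwoDescCl

end
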